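import Summits.BirchSwinnertonDyer.BirchSwinnertonDyer.Theorems.ByReductionTypeAtTwoFineSelmerConjAAtTwoAdditivePotGoodChevalleyDoorAtTwo
import Literature.NumberTheory.NumberFields.ClassNumberDivisibilityInExtensions
import Literature.NumberTheory.NumberFields.QuadraticExtensionOddClassNumberNonNormUnit
import HarnessLib

/-!
# Route `AlignedTransportAtTwo`, crux C2 `MainConjectureOfRankZeroBSDAtTwo` (stmt-BirchSwinnertonDyer-22298):
# THE TWO CHEVALLEY BITS ARE NECESSARY — `e₁ = 0` for the cubic `2`-torsion field `ℚ(β)` forces `h(ℚ(β))` odd AND a unit that is not a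
# norm from `ℚ(β)(√2)`; off the Kilford stratum the first-layer class-number bit and the two displayed bits are EQUIVALENT

HONEST FRAMING (cell `bsd-f1-sign2`, WIDTH-5 attached prover seat `bsd-line-att-p5` gen 29 on line `birth` of the lead `bsd-line-att-p2`;
`--supports` stmt-BirchSwinnertonDyer-22298, closes nothing; BSD is NOT proved by any of this; the crux C2, its verdict «blocked-on
`Rank1Residual.GreenbergMuConjectureIrreducible`» and every registered stub are untouched). THEOREMS ONLY — no definition, no named fact,
no `sorry`. The converse of att-p5 g26/g28's Chevalley door on the cubic class-group road: that door displays `h(ℚ(β))` odd and a non-norm unit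
and yields `e₀ = e₁ = 0`; here `e₁ = 0` alone gives both bits back, on EVERY stratum, because two distinct primes of `ℚ(β)` above `2` ramify in
the first layer `ℚ(β)(√2)` (the degree-one prime cut out by the canonical odd `2`-adic root — `e(w₁|2) = 1` is odd —, and a second one: of odd index
on `Δ_min ≡ 1 (mod 4)` (g27), the prime `𝔭₂` with `e = 2` on `Δ_min ≡ 3 (mod 4)` by g28's ramification transfer), so that in Chevalley's formula
`#Cl(K₁)^G · 2 · [E_K : E_K ∩ N K₁ˣ] = h_K · 2^t` (tree theorem) `t ≥ 2` makes the unit index even, while a prime of `K₁` with `e = 2 = [K₁:K]` gives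
`h_K ∣ h(K₁)` (Washington 4.11, tree).

WHAT.
* §1 (generic `K` of odd degree, `κ` cyclotomic, `K₁ = κ.layer 1`) **`not_two_dvd_classNumber_and_exists_nonNorm_unit_of_classNumberPExp_one_eq_zero`**:
  `e₁(κ) = 0` + two distinct primes of `K` with `e(·, K₁) ≠ 1` ⟹ `2 ∤ h_K` ∧ `∃ ε ∈ (𝓞 K)ˣ, ∀ a b : K, ε ≠ a² − 2b²`.
* §2 **`ramificationIdxIn_layer_one_ne_one_of_odd_ramificationIdx`** (odd `e(w|2)` ⟹ `e(w, K₁) ≠ 1`, Chevalley's currency).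
* The `ℚ(β)` specialisation (two ramified primes on every stratum, NECESSITY, and the off-stratum dictionary
  `e₁(κ) = 0 ⟺ (h(ℚ(β)) odd ∧ a non-norm unit)`) is the sequel `…CubicChevalleyBitsNecessityAdjoin`.

NOT here: that the non-norm unit is detected by the `2`-adic SIGN of the sibling file `…CubicChevalleyUnitSign` (true by Hasse's norm theorem and
the product formula for the quadratic extension `ℚ(β)(√2)/ℚ(β)` with its two ramified places; not kernel). Nothing is asserted about any curve's
class number; nothing is closed; BSD is not proved.

References: [Lang1990] Ch. 13 §4, Lemma 4.1 (PDF pp. 203–204); [Washington1997] Prop. 4.11, §13.1 Lemma 13.3; [Gras2003] IV.4; [NeukirchANT1999]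
Ch. I §8–§9, Ch. II §8; tree: `AmbiguousClassNumberFormula` (Chevalley), `ClassNumberDivisibilityInExtensions`, `QuadraticExtensionOddClassNumber*`,
bsd-2adic k4-w1 `…ChevalleyDoorAtTwo`, att-p5 g26 `…CubicPrimesOfEmbeddings` / `…CubicOffStratumPrimes`, g27 `…CubicOffStratumRamification`,
g28 `…CubicOffStratumFukudaIndex{,Transfer,Tools}`.
-/

set_option linter.dupNamespace false
set_option autoImplicit false

noncomputable section

open scoped Classical NumberField nonZeroDivisors

namespace Summit.BirchSwinnertonDyer.BirchSwinnertonDyer.Theorems.AlignedTransportAtTwoCubicChevalleyBitsNecessity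

open NumberField IsDedekindDomain Polynomial
  Literature.NumberTheory.NumberFields Literature.NumberTheory.NumberFields.AmbiguousClass
  Literature.NumberTheory.NumberFields.AmbiguousIdeal Literature.NumberTheory.GaloisRepresentations
  Literature.NumberTheory.GaloisRepresentations.Herbrand Literature.NumberTheory.GaloisRepresentations.MinkowskiUnit
  Literature.NumberTheory.GaloisRepresentations.CyclicNormIndex Literature.NumberTheory.IwasawaTheory
  Literature.NumberTheory.EllipticCurves
  Summit.BirchSwinnertonDyer.BirchSwinnertonDyer.Theorems.AddKatoTwo

/-! ## §1 Generic: `e₁ = 0` with two ramified primes forces `h_K` odd and a non-norm unit -/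

section Generic

variable {K : Type} [Field K] [NumberField K]

omit [NumberField K] in
/-- `e_1(κ) = 0` read as `2 ∤ h(K₁)`. [folklore] -/
theorem not_two_dvd_classNumber_layer_one_of_classNumberPExp_eq_zero (κ : ZpExtension K 2) [NumberField (κ.layer 1)]
    (h1 : classNumberPExp κ 1 = 0) : ¬ 2 ∣ classNumber (κ.layer 1) := by
  rw [classNumberPExp_eq_padicValNat_classNumber] at h1
  intro hd
  rcases padicValNat.eq_zero_iff.mp h1 with h | h | h
  · exact absurd h (by norm_num)
  · exact absurd h (classNumber_ne_zero (κ.layer 1))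
  · exact h hd


/-- **NECESSITY OF THE TWO CHEVALLEY BITS.** `K` a number field of ODD degree, `κ` a cyclotomic `ℤ₂`-extension of `K` (first layer
`K₁ = K(√2)`), and TWO distinct primes `v₁ ≠ v₂` of `K` ramified in `K₁`. If `e₁(κ) = 0` (`2 ∤ h(K₁)`) then `h_K` is odd AND some unit of `𝓞 K` is
not of the form `a² − 2b²` (`a, b ∈ K`). Proof: a prime of `K₁` above `v₁` has `e = 2 = [K₁ : K]`, so `h_K ∣ h(K₁)` (Washington 4.11, tree); in
Chevalley's formula `#Cl(K₁)^G · 2 · [E_K : E_K ∩ N K₁ˣ] = h_K · 2^t` (`e_∞ = 1`, `√2` is real) the number of ambiguous classes divides `h(K₁)`, hence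
is odd, and `t ≥ 2` forces the norm index to be even: some unit of `K` is not a norm from `K₁ = K ⊕ K√2`, i.e. not an `a² − 2b²`.
[cite: Lang1990, Ch. 13 §4, Lemma 4.1 (PDF pp. 203–204)] [cite: Washington1997, Prop. 4.11 and §13.1] [cite: Gras2003, IV.4] -/
theorem not_two_dvd_classNumber_and_exists_nonNorm_unit_of_classNumberPExp_one_eq_zero (hK2 : ¬ 2 ∣ Module.finrank ℚ K)
    (κ : ZpExtension K 2) (hκ : κ.IsCyclotomic) (h1 : classNumberPExp κ 1 = 0)
    {v₁ v₂ : HeightOneSpectrum (𝓞 K)} (hne : v₁ ≠ v₂)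
    (hv₁ : v₁.asIdeal.ramificationIdxIn (𝓞 (κ.layer 1)) ≠ 1) (hv₂ : v₂.asIdeal.ramificationIdxIn (𝓞 (κ.layer 1)) ≠ 1) :
    ¬ 2 ∣ classNumber K ∧ ∃ ε : 𝓞 K, IsUnit ε ∧ ∀ a b : K, (ε : K) ≠ a ^ 2 - 2 * b ^ 2 := by
  classical
  haveI : FiniteDimensional K (κ.layer 1) := κ.finiteDimensional_layer_holds 1
  haveI : IsGalois K (κ.layer 1) := κ.isGalois_layer_holds 1
  haveI : NumberField (κ.layer 1) := NumberField.of_module_finite K (κ.layer 1)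
  set L := κ.layer 1 with hL
  have hdeg : Module.finrank K L = 2 := by rw [hL, κ.finrank_layer_holds 1, pow_one]
  have hLodd : ¬ 2 ∣ classNumber L := not_two_dvd_classNumber_layer_one_of_classNumberPExp_eq_zero κ h1
  haveI : NoZeroSMulDivisors (𝓞 K) (𝓞 L) := ⟨fun h => smul_eq_zero.mp h⟩
  -- (a) `h_K ∣ h_L` through a prime above `v₁`, of index `2 = [L : K]`
  haveI : v₁.asIdeal.IsPrime := v₁.isPrime
  haveI : v₁.asIdeal.IsMaximal := v₁.isMaximal
  obtain ⟨⟨P, hPprime, hPover⟩⟩ := (inferInstance : Nonempty (Ideal.primesOver v₁.asIdeal (𝓞 L)))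
  haveI := hPprime
  haveI := hPover
  have hP0 : P ≠ ⊥ := fun h => v₁.ne_bot (by
    have := hPover.over; rw [h, Ideal.under_bot] at this; exact this)
  haveI : P.IsMaximal := Ideal.IsPrime.isMaximal hPprime hP0
  have heP : P.ramificationIdx (𝓞 K) = Module.finrank K L := by
    have hle : P.ramificationIdx (𝓞 K) ≤ 2 := by
      have h := Ideal.ramificationIdx_le_finrank (𝓞 L) K L (p := v₁.asIdeal) P
      rw [Ideal.ramificationIdx'_eq_ramificationIdx _ P v₁.ne_bot, hdeg] at h
      exact h
    have hpos : 0 < P.ramificationIdx (𝓞 K) := Ideal.ramificationIdx_pos P (𝓞 K)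
    have hne1 : P.ramificationIdx (𝓞 K) ≠ 1 := by
      rw [← Ideal.ramificationIdxIn_eq_ramificationIdx v₁.asIdeal P (L ≃ₐ[K] L)]; exact hv₁
    rw [hdeg]; omega
  have hKL : classNumber K ∣ classNumber L := classNumber_dvd_classNumber_of_ramificationIdx_eq_finrank K L P heP
  have hKodd : ¬ 2 ∣ classNumber K := fun h => hLodd (h.trans hKL)
  refine ⟨hKodd, ?_⟩
  -- (b) `√2 ∈ L`, the basis `1, s`, unramified at infinity
  obtain ⟨s, hs2⟩ := exists_sq_eq_two_layer_one_of_not_dvd_finrank hK2 κ hκ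
  have hsK : ∀ c : K, algebraMap K L c ≠ s := by
    intro c hc
    apply sq_ne_two_of_odd_finrank hK2 c
    apply (algebraMap K L).injective
    rw [map_pow, hc, hs2, map_ofNat]
  have hli : LinearIndependent K ![(1 : L), s] := by
    refine LinearIndependent.pair_iff.mpr fun a b hab => ?_
    by_cases hb : b = 0
    · subst hb
      simp only [zero_smul, add_zero, smul_eq_zero, one_ne_zero, or_false] at hab
      exact ⟨hab, rfl⟩
    · exfalso
      apply hsK (-(a / b))
      rw [Algebra.smul_def, Algebra.smul_def, mul_one] at hab
      have hb' : algebraMap K L b ≠ 0 := by rwa [Ne, map_eq_zero]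
      rw [map_neg, map_div₀, ← neg_div, div_eq_iff hb']
      linear_combination (-1 : L) * hab
  have hspan : ∀ x : L, ∃ a b : K, x = algebraMap K L a + algebraMap K L b * s := by
    intro x
    let B : Module.Basis (Fin 2) K L := basisOfLinearIndependentOfCardEqFinrank hli (by simp [hdeg])
    have hB : ∀ i, B i = ![(1 : L), s] i := fun i => by simp [B, coe_basisOfLinearIndependentOfCardEqFinrank]
    refine ⟨B.repr x 0, B.repr x 1, ?_⟩
    conv_lhs => rw [← B.sum_repr x]
    rw [Fin.sum_univ_two, hB, hB, Algebra.smul_def, Algebra.smul_def]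
    simp
  haveI : IsUnramifiedAtInfinitePlaces K L := isUnramifiedAtInfinitePlaces_of_sq_eq_two hs2 hspan
  -- (c) Chevalley's formula: `F · 2 · idx = h_K · 2^t`
  obtain ⟨σ, -, -, hσ⟩ := exists_algEquiv_ne_one_of_finrank_eq_two (K := K) (L := L) hdeg
  have hChev := ambiguousClassNumberFormula hσ
  rw [archFactor_eq_one, mul_one, finprod_ramificationIdxIn_eq_pow_of_prime Nat.prime_two hdeg, hdeg] at hChev
  set t := {v : HeightOneSpectrum (𝓞 K) | v.asIdeal.ramificationIdxIn (𝓞 L) ≠ 1}.ncard with htdef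
  set F := Nat.card {c : ClassGroup (𝓞 L) // ∀ τ : L ≃ₐ[K] L, ClassGroup.mulEquiv (intAut τ) c = c} with hFdef
  set H := unitsE L ⊓ (⊤ : Subgroup Lˣ).map (Herbrand.norm (L ≃ₐ[K] L)) with hH
  set E := unitsE L ⊓ (unitsIncl K L).range with hE
  have ht2 : 2 ≤ t := by
    have hsub : ({v₁, v₂} : Set (HeightOneSpectrum (𝓞 K))) ⊆ {v | v.asIdeal.ramificationIdxIn (𝓞 L) ≠ 1} := by
      intro v hv
      simp only [Set.mem_insert_iff, Set.mem_singleton_iff] at hv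
      rcases hv with rfl | rfl
      · exact hv₁
      · exact hv₂
    have := Set.ncard_le_ncard hsub (finite_setOf_ramificationIdxIn_ne_one (K := K) (L := L))
    rwa [Set.ncard_pair hne] at this
  have hFodd : ¬ 2 ∣ F := fun h => hLodd (h.trans (card_fixed_dvd_classNumber (K := K) (L := L)))
  have hidx : 2 ∣ H.relIndex E := by
    obtain ⟨t', ht'⟩ := Nat.exists_eq_add_of_le ht2
    have h4 : 4 ∣ F * 2 * H.relIndex E := ⟨classNumber K * 2 ^ t', by rw [hChev, ht', pow_add]; ring⟩
    obtain ⟨c, hc⟩ := h4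
    have h2 : 2 ∣ F * H.relIndex E := ⟨c, by linarith⟩
    exact (Nat.Prime.dvd_mul Nat.prime_two).mp h2 |>.resolve_left hFodd
  -- (d) an element of `E` outside `H`
  have hEH : ¬ E ≤ H := by
    intro hle
    rw [Subgroup.relIndex_eq_one.mpr hle] at hidx
    exact absurd hidx (by norm_num)
  obtain ⟨u, huE, huH⟩ := Set.not_subset.mp hEH
  obtain ⟨⟨w, hw⟩, ⟨x, hx⟩⟩ := huE
  -- `x ∈ K` is a unit of `𝓞 K`
  have hxval : algebraMap K L (x : K) = algebraMap (𝓞 L) L (w : 𝓞 L) := by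
    have h1 := congrArg (fun z : Lˣ => (z : L)) hx
    have h2 := congrArg (fun z : Lˣ => (z : L)) hw
    simp only [Units.coe_map, MonoidHom.coe_coe] at h1 h2
    exact h1.trans h2.symm
  have hxinv : algebraMap K L ((x⁻¹ : Kˣ) : K) = algebraMap (𝓞 L) L ((w⁻¹ : (𝓞 L)ˣ) : 𝓞 L) := by
    have h1 := congrArg (fun z : Lˣ => (z : L)) (map_inv (unitsIncl K L) x)
    have h2 := congrArg (fun z : Lˣ => (z : L)) (map_inv (Units.map (algebraMap (𝓞 L) L : 𝓞 L →* L)) w)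
    rw [hx] at h1
    rw [hw] at h2
    simp only [Units.coe_map, MonoidHom.coe_coe] at h1 h2
    exact h1.trans h2.symm
  have hint : IsIntegral ℤ (x : K) := by
    have h := RingOfIntegers.isIntegral_coe (w : 𝓞 L)
    rw [← hxval] at h
    exact (isIntegral_algHom_iff (IsScalarTower.toAlgHom ℤ K L) (algebraMap K L).injective).mp h
  have hint' : IsIntegral ℤ ((x⁻¹ : Kˣ) : K) := by
    have h := RingOfIntegers.isIntegral_coe ((w⁻¹ : (𝓞 L)ˣ) : 𝓞 L)
    rw [← hxinv] at h
    exact (isIntegral_algHom_iff (IsScalarTower.toAlgHom ℤ K L) (algebraMap K L).injective).mp h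
  refine ⟨⟨(x : K), hint⟩, ?_, ?_⟩
  · rw [isUnit_iff_exists_inv]
    exact ⟨⟨((x⁻¹ : Kˣ) : K), hint'⟩, Subtype.ext (by change (x : K) * ((x⁻¹ : Kˣ) : K) = 1; rw [← Units.val_mul, mul_inv_cancel, Units.val_one])⟩
  · -- `ε = a² − 2b²` would make `u` a norm
    intro a b hab
    apply huH
    refine ⟨⟨w, hw⟩, ?_⟩
    -- `y = a + b s` is a unit of `L` with `N(y) = ε`
    have hy0 : algebraMap K L a + algebraMap K L b * s ≠ 0 := by
      intro h0
      have hab0 : a = 0 ∧ b = 0 := by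
        have := LinearIndependent.pair_iff.mp hli a b (by
          rw [Algebra.smul_def, Algebra.smul_def, mul_one]; exact h0)
        exact this
      have : (x : K) = 0 := by
        change (x : K) = a ^ 2 - 2 * b ^ 2 at hab
        rw [hab, hab0.1, hab0.2]; ring
      exact x.ne_zero this
    set y : Lˣ := Units.mk0 _ hy0 with hy
    refine ⟨y, Subgroup.mem_top y, ?_⟩
    apply Units.ext
    rw [coe_herbrandNorm_eq_algebraMap_norm hσ y, ← hx, coe_unitsIncl]
    congr 1
    obtain ⟨a', b', hy', hN⟩ := exists_sq_sub_mul_sq_eq_of_norm_eq hdeg (m := (2 : K)) (by rw [hs2, map_ofNat])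
      (by rintro ⟨c, hc⟩; exact hsK c hc) (y : L)
    -- coordinates are unique: `a' = a`, `b' = b`
    have hyval : (y : L) = algebraMap K L a + algebraMap K L b * s := by rw [hy]; rfl
    have hab' : a' = a ∧ b' = b := by
      have h := hyval
      rw [hy'] at h
      have := LinearIndependent.pair_iff.mp hli (a' - a) (b' - b) (by
        rw [Algebra.smul_def, Algebra.smul_def, mul_one, map_sub, map_sub]
        linear_combination h)
      constructor
      · linear_combination this.1
      · linear_combination this.2
    rw [hN, hab'.1, hab'.2]
    change a ^ 2 - 2 * b ^ 2 = (x : K)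
    exact hab.symm

end Generic


/-! ## §2 A tool: odd `e(w|2)` forces `e(w, K₁) ≠ 1` -/

section OddTool

variable {K : Type} [Field K] [NumberField K]

/-- **Odd `e(w|2)` ⟹ `w` is ramified in `K₁ = K(√2)`, in Chevalley's currency** (`e(w, K₁) := ramificationIdxIn ≠ 1`): for a prime `Q ∣ w` of `K₁`,
`e(Q|2) = e(w|2)·e(Q|w)` is even (`√2 ∈ K₁`), so `e(Q|w) ≠ 1`. (The tree's `not_isUnramifiedIn_layer_one_of_odd_ramificationIdx` in the form the
ambiguous class number formula consumes.) [cite: Washington1997, §13.1] [cite: NeukirchANT1999, Ch. I §8] -/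
theorem ramificationIdxIn_layer_one_ne_one_of_odd_ramificationIdx (hK2 : ¬ 2 ∣ Module.finrank ℚ K) (κ : ZpExtension K 2)
    (hκ : κ.IsCyclotomic) {w : HeightOneSpectrum (𝓞 K)} (hw : ((2 : ℕ) : 𝓞 K) ∈ w.asIdeal)
    (hodd : Odd (w.asIdeal.ramificationIdx ℤ)) : w.asIdeal.ramificationIdxIn (𝓞 (κ.layer 1)) ≠ 1 := by
  haveI : FiniteDimensional K (κ.layer 1) := κ.finiteDimensional_layer_holds 1
  haveI : IsGalois K (κ.layer 1) := κ.isGalois_layer_holds 1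
  haveI : NumberField (κ.layer 1) := NumberField.of_module_finite K _
  intro h1
  obtain ⟨θ, hθ⟩ := exists_sq_eq_two_layer_one_of_not_dvd_finrank hK2 κ hκ
  haveI : w.asIdeal.IsPrime := w.isPrime
  haveI : w.asIdeal.LiesOver (Ideal.span {(2 : ℤ)}) := by
    rw [Ideal.liesOver_span_iff w.isPrime.ne_top Int.prime_two, map_ofNat]; exact_mod_cast hw
  obtain ⟨⟨Q, hQprime, hQover⟩⟩ := (inferInstance : Nonempty (Ideal.primesOver w.asIdeal (𝓞 (κ.layer 1))))
  haveI := hQprime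
  haveI := hQover
  haveI : Q.LiesOver (Ideal.span {(2 : ℤ)}) := Ideal.LiesOver.trans Q w.asIdeal _
  have hQ1 : Q.ramificationIdx (𝓞 K) = 1 := by
    rw [← Ideal.ramificationIdxIn_eq_ramificationIdx w.asIdeal Q (κ.layer 1 ≃ₐ[K] κ.layer 1)]; exact h1
  have heven := even_ramificationIdx_int_of_sq_eq_two hθ Q
  rw [Ideal.ramificationIdx_tower w.asIdeal Q, hQ1, mul_one] at heven
  exact (Nat.not_even_iff_odd.mpr hodd) heven

end OddTool

end Summit.BirchSwinnertonDyer.BirchSwinnertonDyer.Theorems.AlignedTransportAtTwoCubicChevalleyBitsNecessity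

end
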